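import Mathlib
import Literature.NumberTheory.LFunctions.WeilMarkovQuadratic
import HarnessLib

/-!
# Window increments through the doubled circle: Parseval for `D_t(g)`

Sub-problem `RiemannHypothesis`, cell `pub-rhpf` (Pf-persistence **mechanism / rigidity campaign; no RH
claims**).  First of three files of **GAL-7 (fixed-window finiteness of the negative index)**.

For a function `g` supported in the window `[-a, a]` we expand it on the circle of length `4a` (the
interval `(-2a, 2a]`, twice the window, so that translates by `|t| < a` never wrap around) and prove the
two Parseval identities the finiteness argument rests on:

* `hasSum_norm_sq_winCoeff`: `Σ_k |ĉ_k|² = (4a)⁻¹ ‖g‖₂²`;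
* `hasSum_winCoeff_increment`: for `0 ≤ t < a`,
  `D_t(g) = ∫ |g(x+t) − g(x)|² dx = 16 a Σ_k |ĉ_k|² sin²(π k t / 4a)`,

where `ĉ_k = winCoeff a g k` is the `k`-th Fourier coefficient of `g` on `(-2a, 2a]` (Mathlib's
`fourierCoeffOn`) and `D_t = weilIncrement` is the increment form of the Weil–Markov decomposition
(`Literature.…WeilMarkovQuadratic`).  The key step is the translate rule
`winCoeff a (g(· + t)) k = e^{2πikt/4a} ĉ_k` (`winCoeff_translate`), valid because the support never
leaves the doubled window.  Everything is elementary real analysis; RH-free.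
[cite: Yoshida1992, §1 p. 282 and Lemma 3] [cite: Bombieri2000Weil, Thm 2 (p. 193)]
-/

noncomputable section

open MeasureTheory Set Filter Topology
open scoped Real

set_option linter.dupNamespace false

namespace Summit.RiemannHypothesis.RiemannHypothesis.Theorems.PfPersistence

open Literature.NumberTheory.LFunctions

/-! ## The doubled-window Fourier coefficients -/

/-- The doubled window is a genuine interval: `-2a < 2a` for `a > 0`. [folklore] -/
theorem neg_two_mul_lt_two_mul {a : ℝ} (ha : 0 < a) : -(2 * a) < 2 * a := by linarith

/-- **Doubled-window Fourier coefficient** `ĉ_k(g)`: the `k`-th Fourier coefficient of `g` on the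
interval `(-2a, 2a]` (circle of length `4a`), i.e. `(4a)⁻¹ ∫_{-2a}^{2a} e^{-2πikx/4a} g(x) dx`; set to `0`
for `a ≤ 0`. [folklore] -/
def winCoeff (a : ℝ) (g : ℝ → ℂ) (k : ℤ) : ℂ :=
  if h : 0 < a then fourierCoeffOn (neg_two_mul_lt_two_mul h) g k else 0

variable {a t : ℝ} {g : ℝ → ℂ} {k : ℤ}

/-- Unfolding: for `a > 0`, `winCoeff a g k = fourierCoeffOn _ g k`. [folklore] -/
theorem winCoeff_eq (ha : 0 < a) : winCoeff a g k = fourierCoeffOn (neg_two_mul_lt_two_mul ha) g k :=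
  dif_pos ha

/-- The exponential character of the doubled window, `x ↦ e^{2πikx/(2a − (−2a))}` composed with the
projection to the circle, is continuous. [folklore] -/
theorem continuous_fourier_coe (T : ℝ) (n : ℤ) : Continuous fun x : ℝ ↦ fourier n (x : AddCircle T) :=
  (fourier n).continuous.comp continuous_quotient_mk'

/-- Integral form: `winCoeff a g k = (4a)⁻¹ ∫_{-2a}^{2a} e_{-k}(x) g(x) dx`. [folklore] -/
theorem winCoeff_eq_integral (ha : 0 < a) :
    winCoeff a g k = (1 / (2 * a - -(2 * a))) •
      ∫ x in (-(2 * a))..(2 * a), fourier (-k) (x : AddCircle (2 * a - -(2 * a))) • g x := by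
  rw [winCoeff_eq ha, fourierCoeffOn_eq_integral]

/-- Linearity: `ĉ_k(c g) = c ĉ_k(g)`. [folklore] -/
theorem winCoeff_const_mul (c : ℂ) : winCoeff a (fun x ↦ c * g x) k = c * winCoeff a g k := by
  by_cases ha : 0 < a
  · rw [winCoeff_eq ha, winCoeff_eq ha, fourierCoeffOn.const_mul]
  · simp [winCoeff, ha]

/-- The integrand `e_{-k}(x) • u(x)` of a doubled-window coefficient is interval integrable for
continuous `u`. [folklore] -/
theorem intervalIntegrable_fourier_smul {u : ℝ → ℂ} (hu : Continuous u) (T c d : ℝ) (n : ℤ) :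
    IntervalIntegrable (fun x : ℝ ↦ fourier n (x : AddCircle T) • u x) volume c d := by
  apply Continuous.intervalIntegrable
  exact (continuous_fourier_coe T n).smul hu

/-- Linearity: `ĉ_k(g + h) = ĉ_k(g) + ĉ_k(h)` for continuous `g, h`. [folklore] -/
theorem winCoeff_add {h : ℝ → ℂ} (hg : Continuous g) (hh : Continuous h) :
    winCoeff a (fun x ↦ g x + h x) k = winCoeff a g k + winCoeff a h k := by
  by_cases ha : 0 < a
  · rw [winCoeff_eq_integral ha, winCoeff_eq_integral ha, winCoeff_eq_integral ha, ← smul_add,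
      ← intervalIntegral.integral_add (intervalIntegrable_fourier_smul hg _ _ _ _)
        (intervalIntegrable_fourier_smul hh _ _ _ _)]
    simp only [smul_add]
  · simp [winCoeff, ha]

/-- Linearity: `ĉ_k(g − h) = ĉ_k(g) − ĉ_k(h)` for continuous `g, h`. [folklore] -/
theorem winCoeff_sub {h : ℝ → ℂ} (hg : Continuous g) (hh : Continuous h) :
    winCoeff a (fun x ↦ g x - h x) k = winCoeff a g k - winCoeff a h k := by
  have h2 : (fun x ↦ g x - h x) = fun x ↦ g x + (-1 : ℂ) * h x := by
    funext x
    ring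
  have hc : Continuous fun x ↦ (-1 : ℂ) * h x := by fun_prop
  rw [h2, winCoeff_add hg hc, winCoeff_const_mul]
  ring

/-- Linearity over finite real combinations: `ĉ_k(Σ cᵢ gᵢ) = Σ cᵢ ĉ_k(gᵢ)`. [folklore] -/
theorem winCoeff_sum_smul {ι : Type*} [Fintype ι] {G : ι → ℝ → ℂ} (hG : ∀ i, Continuous (G i))
    (c : ι → ℝ) :
    winCoeff a (fun x ↦ ∑ i, (c i : ℂ) * G i x) k = ∑ i, (c i : ℂ) * winCoeff a (G i) k := by
  classical
  by_cases ha : 0 < a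
  · simp only [winCoeff_eq_integral ha, Finset.smul_sum]
    have hc : ∀ i, Continuous fun x ↦ (c i : ℂ) * G i x := fun i ↦ by fun_prop
    rw [intervalIntegral.integral_finsetSum fun i _ ↦ intervalIntegrable_fourier_smul (hc i) _ _ _ _]
    rw [Finset.smul_sum]
    refine Finset.sum_congr rfl fun i _ ↦ ?_
    have hfun : (fun x : ℝ ↦ fourier (-k) (x : AddCircle (2 * a - -(2 * a))) • ((c i : ℂ) * G i x)) =
        fun x : ℝ ↦ (c i : ℂ) • (fourier (-k) (x : AddCircle (2 * a - -(2 * a))) • G i x) := by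
      funext x
      simp only [smul_eq_mul]
      ring
    rw [hfun, intervalIntegral.integral_smul, smul_comm, smul_eq_mul]
  · simp [winCoeff, ha]

/-! ## Support bookkeeping -/

/-- A function supported in `[-a, a]` has `x ↦ F x * g x` supported in `(-2a + t, 2a + t]` whenever
`|t| < a`. [folklore] -/
theorem support_mul_subset_Ioc (hsupp : Function.support g ⊆ Icc (-a) a) (ht : |t| < a)
    (F : ℝ → ℂ) :
    Function.support (fun x ↦ F x * g x) ⊆ Ioc (-(2 * a) + t) (2 * a + t) := by
  intro x hx
  have hgx : g x ≠ 0 := fun h ↦ hx (by simp [h])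
  have hxI := hsupp hgx
  rw [abs_lt] at ht
  exact ⟨by linarith [hxI.1], by linarith [hxI.2]⟩

/-- Window shift: `∫_{-2a+t}^{2a+t} F g = ∫_{-2a}^{2a} F g` for `g` supported in `[-a, a]`, `|t| < a`
(both equal the integral over `ℝ`). [folklore] -/
theorem intervalIntegral_shift_window (ha : 0 < a) (hsupp : Function.support g ⊆ Icc (-a) a)
    (ht : |t| < a) (F : ℝ → ℂ) :
    ∫ x in (-(2 * a) + t)..(2 * a + t), F x * g x = ∫ x in (-(2 * a))..(2 * a), F x * g x := by
  rw [intervalIntegral.integral_eq_integral_of_support_subset (support_mul_subset_Ioc hsupp ht F),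
    intervalIntegral.integral_eq_integral_of_support_subset]
  simpa using support_mul_subset_Ioc hsupp (t := 0) (by simpa using ha) F

/-! ## Translates and increments -/

/-- **Translate rule.** For `g` supported in `[-a, a]` and `|t| < a`:
`ĉ_k(g(· + t)) = e^{2πikt/4a} · ĉ_k(g)` — the translate never wraps around the doubled circle.
[folklore] -/
theorem winCoeff_translate (ha : 0 < a) (hsupp : Function.support g ⊆ Icc (-a) a) (ht : |t| < a) :
    winCoeff a (fun x ↦ g (x + t)) k =
      fourier k (t : AddCircle (2 * a - -(2 * a))) * winCoeff a g k := by
  rw [winCoeff_eq_integral ha, winCoeff_eq_integral ha]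
  set T : ℝ := 2 * a - -(2 * a) with hT
  have hmul : ∀ x : ℝ, fourier (-k) (x : AddCircle T) • g (x + t) =
      fourier k (t : AddCircle T) * (fourier (-k) ((x + t : ℝ) : AddCircle T) * g (x + t)) := by
    intro x
    rw [smul_eq_mul, ← mul_assoc]
    congr 1
    simp only [fourier_coe_apply, ← Complex.exp_add]
    congr 1
    push_cast
    ring
  simp_rw [hmul]
  rw [intervalIntegral.integral_const_mul,
    intervalIntegral.integral_comp_add_right (fun x : ℝ ↦ fourier (-k) (x : AddCircle T) * g x) t,
    intervalIntegral_shift_window ha hsupp ht]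
  simp only [smul_eq_mul, Complex.real_smul]
  ring

/-- The increment function `x ↦ g(x+t) − g(x)` of a function supported in `[-a, a]`, `0 ≤ t < a`, is
supported in `(-2a, 2a]`. [folklore] -/
theorem support_increment_subset (ha : 0 < a) (hsupp : Function.support g ⊆ Icc (-a) a)
    (ht0 : 0 ≤ t) (hta : t < a) :
    Function.support (fun x ↦ g (x + t) - g x) ⊆ Ioc (-(2 * a)) (2 * a) := by
  intro x hx
  rw [Function.mem_support] at hx
  by_cases h1 : g (x + t) = 0
  · have h2 : g x ≠ 0 := fun h ↦ hx (by simp [h1, h])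
    have := hsupp h2
    exact ⟨by linarith [this.1], by linarith [this.2]⟩
  · have := hsupp h1
    exact ⟨by linarith [this.1], by linarith [this.2]⟩

/-- `‖e_k(t) − 1‖² = 4 sin²(πkt/4a)` on the circle of length `4a`. [folklore] -/
theorem norm_fourier_sub_one_sq (a t : ℝ) (k : ℤ) :
    ‖fourier k (t : AddCircle (2 * a - -(2 * a))) - 1‖ ^ 2 =
      4 * Real.sin (π * k * t / (4 * a)) ^ 2 := by
  have h : fourier k (t : AddCircle (2 * a - -(2 * a))) =
      Complex.exp (Complex.I * ((2 * π * k * t / (4 * a) : ℝ) : ℂ)) := by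
    rw [fourier_coe_apply]
    congr 1
    push_cast
    ring
  rw [h, Complex.norm_exp_I_mul_ofReal_sub_one, Real.norm_eq_abs, sq_abs]
  have : 2 * π * k * t / (4 * a) / 2 = π * k * t / (4 * a) := by ring
  rw [this]
  ring

/-- A continuous function supported in `[-a, a]` has compact support. [folklore] -/
theorem hasCompactSupport_of_support_subset (hsupp : Function.support g ⊆ Icc (-a) a) :
    HasCompactSupport g :=
  HasCompactSupport.of_support_subset_isCompact isCompact_Icc hsupp

/-- **Parseval on the doubled window.** For continuous `g` supported in `[-a, a]`:
`Σ_k |ĉ_k|² = (4a)⁻¹ ∫ |g|²`. [folklore] -/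
theorem hasSum_norm_sq_winCoeff (ha : 0 < a) (hg : Continuous g)
    (hsupp : Function.support g ⊆ Icc (-a) a) :
    HasSum (fun k : ℤ ↦ ‖winCoeff a g k‖ ^ 2) ((4 * a)⁻¹ * ∫ x, ‖g x‖ ^ 2) := by
  have hL2 : MemLp g 2 (volume.restrict (Ioc (-(2 * a)) (2 * a))) :=
    (hg.memLp_of_hasCompactSupport (hasCompactSupport_of_support_subset hsupp)).restrict _
  have h := hasSum_sq_fourierCoeffOn (neg_two_mul_lt_two_mul ha) hL2
  have hsupp2 : Function.support (fun x ↦ ‖g x‖ ^ 2) ⊆ Ioc (-(2 * a)) (2 * a) := by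
    intro x hx
    have hgx : g x ≠ 0 := fun h0 ↦ hx (by simp [h0])
    have := hsupp hgx
    exact ⟨by linarith [this.1], by linarith [this.2]⟩
  rw [intervalIntegral.integral_eq_integral_of_support_subset hsupp2, smul_eq_mul] at h
  have h4 : (2 * a - -(2 * a))⁻¹ = (4 * a)⁻¹ := by ring
  simp_rw [winCoeff_eq ha]
  rwa [h4] at h

/-- **Parseval for increments.** For continuous `g` supported in `[-a, a]` and `0 ≤ t < a`:
`D_t(g) = 16 a · Σ_k |ĉ_k|² sin²(π k t / 4a)` (as a `HasSum`). [cite: Yoshida1992, Lemma 3 (proof)] -/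
theorem hasSum_winCoeff_increment (ha : 0 < a) (hg : Continuous g)
    (hsupp : Function.support g ⊆ Icc (-a) a) (ht0 : 0 ≤ t) (hta : t < a) :
    HasSum (fun k : ℤ ↦ 16 * a * (‖winCoeff a g k‖ ^ 2 * Real.sin (π * k * t / (4 * a)) ^ 2))
      (weilIncrement g t) := by
  set f : ℝ → ℂ := fun x ↦ g (x + t) - g x with hf
  have hfc : Continuous f := by
    rw [hf]
    fun_prop
  have hfsupp := support_increment_subset ha hsupp ht0 hta
  have hfK : HasCompactSupport f :=
    HasCompactSupport.of_support_subset_isCompact isCompact_Icc (hfsupp.trans Ioc_subset_Icc_self)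
  have hL2 : MemLp f 2 (volume.restrict (Ioc (-(2 * a)) (2 * a))) :=
    (hfc.memLp_of_hasCompactSupport hfK).restrict _
  have h := hasSum_sq_fourierCoeffOn (neg_two_mul_lt_two_mul ha) hL2
  have hsupp2 : Function.support (fun x ↦ ‖f x‖ ^ 2) ⊆ Ioc (-(2 * a)) (2 * a) := by
    intro x hx
    apply hfsupp
    intro h0
    apply hx
    have h0' : f x = 0 := h0
    simp [h0']
  rw [intervalIntegral.integral_eq_integral_of_support_subset hsupp2, smul_eq_mul] at h
  have hD : (∫ x, ‖f x‖ ^ 2) = weilIncrement g t := rfl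
  rw [hD] at h
  -- the coefficients of the increment function
  have hta' : |t| < a := abs_lt.2 ⟨by linarith, hta⟩
  have hcoef : ∀ k : ℤ, fourierCoeffOn (neg_two_mul_lt_two_mul ha) f k =
      (fourier k (t : AddCircle (2 * a - -(2 * a))) - 1) * winCoeff a g k := by
    intro k
    have hgt : Continuous fun x ↦ g (x + t) := hg.comp (continuous_id.add continuous_const)
    rw [← winCoeff_eq ha, hf, winCoeff_sub hgt hg, winCoeff_translate ha hsupp hta']
    ring
  simp_rw [hcoef, norm_mul, mul_pow, norm_fourier_sub_one_sq] at h
  have h4 : (2 * a - -(2 * a))⁻¹ = (4 * a)⁻¹ := by ring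
  rw [h4] at h
  have h16 := h.mul_left (4 * a)
  rw [← mul_assoc, mul_inv_cancel₀ (by positivity : (4 * a : ℝ) ≠ 0), one_mul] at h16
  have hfun : (fun k : ℤ ↦ 16 * a * (‖winCoeff a g k‖ ^ 2 * Real.sin (π * k * t / (4 * a)) ^ 2)) =
      fun i : ℤ ↦ 4 * a * (4 * Real.sin (π * i * t / (4 * a)) ^ 2 * ‖winCoeff a g i‖ ^ 2) := by
    funext k
    ring
  rw [hfun]
  exact h16

end Summit.RiemannHypothesis.RiemannHypothesis.Theorems.PfPersistence

end
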